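import Summits.HubbardSuperconductivity.HubbardSuperconductivity.Theorems.AnisotropyChordTowerFirstOrder
import Summits.HubbardSuperconductivity.HubbardSuperconductivity.Theorems.AnisotropyChordTowerBootstrap

/-!
# Route `AnisotropyChord` / H0 rotor rung: THE SECOND-ORDER DEFICIT ENVELOPE of a Perron sector ground amplitude near the
# ferromagnetic point (work-order v13(e), first half, of theory seat `hubbard-h0-rotor-theory-1`, memo ROTOR-THEORY-11
# §160 (γ2)–(γ3), §161 (e); director CYCLE-12 ruling (A))

For the torus `(ℤ/L)²` (constant vertex degree `d`), a middle sector `n = k + 2 ≤ |V|`, the solved two-magnon vector `v`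
(`…TowerLowestWeight.exists_solved_twoMagnon`) and `pOne k v = ‖(S⁺)^k ext v‖² / (|Sec n|·(k!)²)` (the squared norm of the
first-order correction `φ₁`):

* `alpha_sq_le_one`, `inner_top_eq_inner_chi` (abstract bookkeeping);
* **`perron_deficit_envelope`** : there are `C₄, C₅ ≥ 0` depending only on `(L, k, v)` such that for every `η ∈ [0,1]`,
  every Perron amplitude `a` of `H(1 − η)` in the sector `n` and every `s ∈ (0,1]`:
  `|⟨ψ, B_n ψ⟩ − η²(|V|−1)·pOne| ≤ (s + C₄η²)·η²(|V|−1)·pOne + (1 + s⁻¹)·C₅·η³`, `ψ = res a`, `B_n` the complete-graph form —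
  i.e. the spin deficit `S(S+1) − ⟨S⃗²⟩ = 2⟨ψ, B_nψ⟩` (`totalSpinSq_eq_sub_two_inner_fmOp_top`) is `2η²(2S−1)·pOne(n) + o(η²)`
  uniformly in the state (assembled from `Tower.bootstrap`, `Tower.deficit_expansion`, `secOp_gap`, `secW_const`, `secOp_rV`,
  `sum_rV_eq_zero`, `secOp_top_rV`, `perron_sec_min`).
-/

set_option linter.dupNamespace false
set_option autoImplicit false

noncomputable section

open Finset Matrix
open Summit.HubbardSuperconductivity.HubbardSuperconductivity.Theorems.AnisotropyChord.InsertionEntropy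
open Literature.MathematicalPhysics.QuantumLattice Literature.Probability.LatticeModels

namespace Summit.HubbardSuperconductivity.HubbardSuperconductivity.Theorems.AnisotropyChord.Tower

/-! ### Abstract bookkeeping -/

section Abstract

variable {ι : Type} [Fintype ι]

/-- `α = ⟨φ₀, ψ⟩` of two unit vectors has `α² ≤ 1`. [folklore] -/
theorem alpha_sq_le_one (φ₀ ψ : ι → ℝ) (h00 : φ₀ ⬝ᵥ φ₀ = 1) (hψ : ψ ⬝ᵥ ψ = 1) : (φ₀ ⬝ᵥ ψ) ^ 2 ≤ 1 := by
  set α := φ₀ ⬝ᵥ ψ with hα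
  have hχ : 0 ≤ (ψ - α • φ₀) ⬝ᵥ (ψ - α • φ₀) := by
    unfold dotProduct; exact Finset.sum_nonneg fun i _ => mul_self_nonneg _
  have hexp : (ψ - α • φ₀) ⬝ᵥ (ψ - α • φ₀) = 1 - α ^ 2 := by
    simp only [sub_dotProduct, dotProduct_sub, dotProduct_smul, smul_dotProduct, hψ, h00, dotProduct_comm ψ φ₀, ← hα,
      smul_eq_mul]
    ring
  linarith

/-- With `B φ₀ = 0` and `B` symmetric, `⟨ψ, Bψ⟩ = ⟨χ, Bχ⟩` for `χ = ψ − αφ₀ = ηαφ₁ + ρ`. [folklore] -/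
theorem inner_top_eq_inner_chi (B : (ι → ℝ) →ₗ[ℝ] (ι → ℝ)) (hB : ∀ f g : ι → ℝ, f ⬝ᵥ B g = B f ⬝ᵥ g)
    (φ₀ φ₁ ψ ρ : ι → ℝ) (η α : ℝ) (hBφ₀ : B φ₀ = 0) (hρdef : ρ = ψ - α • φ₀ - (η * α) • φ₁) :
    ψ ⬝ᵥ B ψ = ((η * α) • φ₁ + ρ) ⬝ᵥ B ((η * α) • φ₁ + ρ) := by
  have hψ : ψ = α • φ₀ + ((η * α) • φ₁ + ρ) := by rw [hρdef]; abel
  set χ := (η * α) • φ₁ + ρ with hχ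
  rw [hψ, map_add, map_smul, hBφ₀, smul_zero, zero_add, add_dotProduct, smul_dotProduct, hB φ₀ χ, hBφ₀,
    zero_dotProduct, smul_zero, zero_add]

end Abstract

/-! ### The deficit envelope on a torus sector -/

section Envelope

variable {V : Type} [Fintype V] [DecidableEq V]

/-- `pOne k v = ‖rV‖² / (|Sec (k+2)|·(k!)²)` — the squared norm `‖φ₁‖²` of the first-order correction. [folklore] -/
def pOne (k : ℕ) (v : Sec V 2 → ℝ) : ℝ :=
  (rV k v ⬝ᵥ rV k v) / ((Fintype.card (Sec V (k + 2)) : ℝ) * (k.factorial : ℝ) ^ 2)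

omit [DecidableEq V] in
/-- `⟨c·1, f⟩ = c·Σ f`. [folklore] -/
theorem const_dot_eq {n : ℕ} [DecidableEq V] (c : ℝ) (f : Sec V n → ℝ) : (fun _ : Sec V n => c) ⬝ᵥ f = c * ∑ s, f s := by
  unfold dotProduct; rw [Finset.mul_sum]

variable {L : ℕ} [NeZero L]

/-- **THE SECOND-ORDER DEFICIT ENVELOPE** (uniform in the state): see the module doc. [folklore] -/
theorem perron_deficit_envelope (d : ℕ) (κ : ℝ)
    (hreg : ∀ x : TorusSite 2 L, (∑ y, if (torusGraph 2 L).Adj x y then (1:ℝ) else 0) = d)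
    (k : ℕ) (hk : k + 2 ≤ Fintype.card (TorusSite 2 L))
    (v : Sec (TorusSite 2 L) 2 → ℝ) (hv : ∑ s, v s = 0)
    (hAv : secOp (torusGraph 2 L) 2 v = secRes 2 (edgeMinusMean (torusGraph 2 L) κ))
    (hlow : lowerSum (secExt 2 v) = fun _ => 0) :
    ∃ C₄ C₅ : ℝ, 0 ≤ C₄ ∧ 0 ≤ C₅ ∧
      ∀ η : ℝ, 0 ≤ η → η ≤ 1 → ∀ (M : ℝ) (a : TensorIndex (TorusSite 2 L) 2 → ℝ),
        IsPerronSectorGroundAmplitude L (1 - η) M a →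
        (((k + 2 : ℕ) : ℝ) = (Fintype.card (TorusSite 2 L) : ℝ) / 2 + M) →
        ∀ s : ℝ, 0 < s → s ≤ 1 →
          |secRes (k + 2) a ⬝ᵥ secOp (⊤ : SimpleGraph (TorusSite 2 L)) (k + 2) (secRes (k + 2) a)
              - η ^ 2 * (((Fintype.card (TorusSite 2 L) : ℝ) - 1) * pOne k v)|
            ≤ (s + C₄ * η ^ 2) * (η ^ 2 * (((Fintype.card (TorusSite 2 L) : ℝ) - 1) * pOne k v))
              + (1 + s⁻¹) * C₅ * η ^ 3 := by
  set G := torusGraph 2 L with hG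
  have hconn : G.Connected := torusGraph_connected_of_proj 2 L
  -- the normalised flat vector `φ₀`
  set Nsq : ℝ := (Fintype.card (Sec (TorusSite 2 L) (k + 2)) : ℝ) with hNsq
  have hNsq_pos : 0 < Nsq := by
    rw [hNsq, card_sec]; exact_mod_cast Nat.choose_pos hk
  set N : ℝ := Real.sqrt Nsq with hNdef
  have hN : 0 < N := Real.sqrt_pos.2 hNsq_pos
  have hN2 : N ^ 2 = Nsq := Real.sq_sqrt hNsq_pos.le
  set φ₀ : Sec (TorusSite 2 L) (k + 2) → ℝ := fun _ => N⁻¹ with hφ₀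
  have h00 : φ₀ ⬝ᵥ φ₀ = 1 := by
    rw [hφ₀, const_dot_eq, Finset.sum_const, Finset.card_univ, nsmul_eq_mul, ← hNsq, ← hN2]
    field_simp
  have hφ₀dot : ∀ χ : Sec (TorusSite 2 L) (k + 2) → ℝ, φ₀ ⬝ᵥ χ = 0 → ∑ s, χ s = 0 := by
    intro χ h
    rw [hφ₀, const_dot_eq] at h
    rcases mul_eq_zero.1 h with h | h
    · exact absurd h (inv_ne_zero hN.ne')
    · exact h
  -- the operators
  set A := secOp G (k + 2) with hA
  set W := secW G (k + 2) with hW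
  set B := secOp (⊤ : SimpleGraph (TorusSite 2 L)) (k + 2) with hB
  have hAs : ∀ f g : Sec (TorusSite 2 L) (k + 2) → ℝ, f ⬝ᵥ A g = A f ⬝ᵥ g := fun f g => secOp_symm G f g
  have hWs : ∀ f g : Sec (TorusSite 2 L) (k + 2) → ℝ, f ⬝ᵥ W g = W f ⬝ᵥ g := fun f g => secW_symm G f g
  have hBs : ∀ f g : Sec (TorusSite 2 L) (k + 2) → ℝ, f ⬝ᵥ B g = B f ⬝ᵥ g := fun f g => secOp_symm ⊤ f g
  have hBpsd : ∀ f : Sec (TorusSite 2 L) (k + 2) → ℝ, 0 ≤ f ⬝ᵥ B f := fun f => secOp_psd ⊤ f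
  have hAφ₀ : A φ₀ = 0 := secOp_const G N⁻¹
  have hBφ₀ : B φ₀ = 0 := secOp_const ⊤ N⁻¹
  -- the first-order correction `φ₁` and the one-magnon closure
  set c : ℝ := N⁻¹ / (k.factorial : ℝ) with hc
  set φ₁ : Sec (TorusSite 2 L) (k + 2) → ℝ := (-c) • rV k v with hφ₁
  set D : ℝ := ∑ x, ∑ y, if G.Adj x y then (1:ℝ) else 0 with hD
  set w₀ : ℝ := (1/8 : ℝ) * D - (d : ℝ) * (k + 2 : ℕ) / 2 + κ * ((k + 2).choose 2 : ℕ) with hw₀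
  have hWφ₀ : W φ₀ = w₀ • φ₀ + c • rU G k κ := by
    rw [hW, hφ₀, secW_const G d κ hreg k N⁻¹]
  have hfirst : A φ₁ = -(W φ₀ - w₀ • φ₀) := by
    rw [hWφ₀, hφ₁, map_smul, hA, secOp_rV G k κ v hAv, add_sub_cancel_left, neg_smul]
  have h01 : φ₀ ⬝ᵥ φ₁ = 0 := by
    rw [hφ₀, const_dot_eq, hφ₁]
    simp only [Pi.smul_apply, smul_eq_mul]
    rw [← Finset.mul_sum, sum_rV_eq_zero k v hv hlow]; ring
  -- the gap
  obtain ⟨γ, hγ, hgapS⟩ := secOp_gap G hconn (k + 2)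
  have hgap : ∀ χ : Sec (TorusSite 2 L) (k + 2) → ℝ, φ₀ ⬝ᵥ χ = 0 → γ * (χ ⬝ᵥ χ) ≤ χ ⬝ᵥ A χ :=
    fun χ h => hgapS χ (hφ₀dot χ h)
  -- the perturbation bound
  set wmax : ℝ := (1/8 : ℝ) * D with hwmax
  have hwmax0 : 0 ≤ wmax := by
    rw [hwmax, hD]
    exact mul_nonneg (by norm_num) (Finset.sum_nonneg fun x _ => Finset.sum_nonneg fun y _ => by
      split_ifs <;> norm_num)
  have hWb : ∀ x : Sec (TorusSite 2 L) (k + 2) → ℝ, |x ⬝ᵥ W x| ≤ wmax * (x ⬝ᵥ x) := fun x => abs_dot_secW_le G x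
  -- the complete-graph form: bound and the eigen-relation on `φ₁`
  set β : ℝ := (1/2 : ℝ) * ∑ x, ∑ y, if (⊤ : SimpleGraph (TorusSite 2 L)).Adj x y then (1:ℝ) else 0 with hβ
  have hβ0 : 0 ≤ β := mul_nonneg (by norm_num) (Finset.sum_nonneg fun x _ => Finset.sum_nonneg fun y _ => by
      split_ifs <;> norm_num)
  have hBle : ∀ x : Sec (TorusSite 2 L) (k + 2) → ℝ, x ⬝ᵥ B x ≤ β * (x ⬝ᵥ x) := fun x => secOp_le ⊤ x
  set lam : ℝ := (Fintype.card (TorusSite 2 L) : ℝ) - 1 with hlam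
  have hlam0 : 0 ≤ lam := by
    rw [hlam, sub_nonneg]; exact_mod_cast (show 1 ≤ Fintype.card (TorusSite 2 L) by omega)
  have hBφ₁ : B φ₁ = lam • φ₁ := by
    rw [hφ₁, map_smul, hB, secOp_top_rV k v hlow, smul_comm]
  -- `p₁ = ‖φ₁‖² = pOne`
  set p₁ : ℝ := φ₁ ⬝ᵥ φ₁ with hp₁
  have hp₁_eq : p₁ = pOne k v := by
    rw [hp₁, hφ₁, smul_dotProduct, dotProduct_smul, smul_eq_mul, smul_eq_mul, pOne, ← hNsq, ← hN2, hc]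
    have hkf : (k.factorial : ℝ) ≠ 0 := by exact_mod_cast (Nat.factorial_pos k).ne'
    field_simp
  have hp₁0 : 0 ≤ p₁ := by
    rw [hp₁]; unfold dotProduct; exact Finset.sum_nonneg fun i _ => mul_self_nonneg _
  have hφ₁B : φ₁ ⬝ᵥ B φ₁ = lam * p₁ := by rw [hBφ₁, dotProduct_smul, smul_eq_mul, hp₁]
  -- the bootstrap constants
  set c₁ : ℝ := |φ₁ ⬝ᵥ W φ₁| + p₁ * wmax with hc₁
  set K₂ : ℝ := wmax + |w₀| + c₁ with hK₂
  set K₃ : ℝ := K₂ * (|w₀| + wmax) + γ * c₁ with hK₃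
  set K₄ : ℝ := 2 * γ ^ 2 * p₁ + 2 * K₃ with hK₄
  set K₅ : ℝ := K₄ * (|w₀| + wmax) + γ ^ 2 * c₁ with hK₅
  have hc₁0 : 0 ≤ c₁ := add_nonneg (abs_nonneg _) (mul_nonneg hp₁0 hwmax0)
  have hK₂0 : 0 ≤ K₂ := add_nonneg (add_nonneg hwmax0 (abs_nonneg _)) hc₁0
  have hK₃0 : 0 ≤ K₃ := add_nonneg (mul_nonneg hK₂0 (add_nonneg (abs_nonneg _) hwmax0)) (mul_nonneg hγ.le hc₁0)
  have hK₄0 : 0 ≤ K₄ :=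
    add_nonneg (mul_nonneg (mul_nonneg (by norm_num) (sq_nonneg _)) hp₁0) (mul_nonneg (by norm_num) hK₃0)
  have hK₅0 : 0 ≤ K₅ := add_nonneg (mul_nonneg hK₄0 (add_nonneg (abs_nonneg _) hwmax0)) (mul_nonneg (sq_nonneg _) hc₁0)
  refine ⟨K₄ / γ ^ 2, β * K₅ / γ ^ 3, div_nonneg hK₄0 (sq_nonneg _),
    div_nonneg (mul_nonneg hβ0 hK₅0) (pow_nonneg hγ.le 3), ?_⟩
  intro η hη0 hη1 M a ha hn s hs hs1
  -- the state
  set ψ : Sec (TorusSite 2 L) (k + 2) → ℝ := secRes (k + 2) a with hψ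
  have hψ1 : ψ ⬝ᵥ ψ = 1 := perron_sec_unit ha hn
  have hmin : ∀ b : Sec (TorusSite 2 L) (k + 2) → ℝ,
      (ψ ⬝ᵥ (A ψ + η • W ψ)) * (b ⬝ᵥ b) ≤ b ⬝ᵥ (A b + η • W b) := by
    intro b
    have h := perron_sec_min ha hn b
    have e : (1:ℝ) - (1 - η) = η := by ring
    rw [e] at h
    exact h
  set α : ℝ := φ₀ ⬝ᵥ ψ with hα
  set ρ : Sec (TorusSite 2 L) (k + 2) → ℝ := ψ - α • φ₀ - (η * α) • φ₁ with hρ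
  obtain ⟨hb1, hb2⟩ := bootstrap A W hAs hWs φ₀ φ₁ ψ ρ η w₀ γ wmax α p₁ c₁ K₂ K₃ K₄ K₅ hAφ₀ h00 h01 hfirst hγ hgap
    hwmax0 hWb hη0 hη1 hψ1 hmin hα hρ hp₁ hc₁ hK₂ hK₃ hK₄ hK₅
  have hα1 : α ^ 2 ≤ 1 := by rw [hα]; exact alpha_sq_le_one φ₀ ψ h00 hψ1
  -- the deficit
  have hdef := deficit_expansion B hBs hBpsd φ₁ ρ η α lam p₁ β s hφ₁B (mul_nonneg hlam0 hp₁0) (hBle ρ) hs hs1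
  rw [← inner_top_eq_inner_chi B hBs φ₀ φ₁ ψ ρ η α hBφ₀ hρ] at hdef
  -- assemble
  have hρρ : ρ ⬝ᵥ ρ ≤ K₅ * η ^ 3 / γ ^ 3 := by
    rw [le_div_iff₀ (pow_pos hγ 3)]; linarith
  have h1α : 1 - α ^ 2 ≤ K₄ * η ^ 2 / γ ^ 2 := by
    rw [le_div_iff₀ (pow_pos hγ 2)]; linarith
  have hlp : 0 ≤ lam * p₁ := mul_nonneg hlam0 hp₁0
  rw [← hp₁_eq]
  have htri : |ψ ⬝ᵥ B ψ - η ^ 2 * (lam * p₁)|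
      ≤ |ψ ⬝ᵥ B ψ - η ^ 2 * α ^ 2 * (lam * p₁)| + η ^ 2 * (lam * p₁) * (1 - α ^ 2) := by
    have e : ψ ⬝ᵥ B ψ - η ^ 2 * (lam * p₁)
        = (ψ ⬝ᵥ B ψ - η ^ 2 * α ^ 2 * (lam * p₁)) - η ^ 2 * (lam * p₁) * (1 - α ^ 2) := by ring
    rw [e]
    refine le_trans (abs_sub _ _) ?_
    rw [abs_of_nonneg (mul_nonneg (mul_nonneg (sq_nonneg η) hlp) (sub_nonneg.2 hα1))]
  have hE1 : s * (η ^ 2 * α ^ 2 * (lam * p₁)) ≤ s * (η ^ 2 * (lam * p₁)) := by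
    apply mul_le_mul_of_nonneg_left _ hs.le
    have h := mul_le_mul_of_nonneg_left hα1 (mul_nonneg (sq_nonneg η) hlp)
    calc η ^ 2 * α ^ 2 * (lam * p₁) = η ^ 2 * (lam * p₁) * α ^ 2 := by ring
      _ ≤ η ^ 2 * (lam * p₁) * 1 := h
      _ = η ^ 2 * (lam * p₁) := by ring
  have hE2 : (1 + s⁻¹) * (β * (ρ ⬝ᵥ ρ)) ≤ (1 + s⁻¹) * (β * K₅ / γ ^ 3) * η ^ 3 := by
    have h1 : β * (ρ ⬝ᵥ ρ) ≤ β * (K₅ * η ^ 3 / γ ^ 3) := mul_le_mul_of_nonneg_left hρρ hβ0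
    have h2 : 0 ≤ 1 + s⁻¹ := add_nonneg zero_le_one (inv_nonneg.2 hs.le)
    calc (1 + s⁻¹) * (β * (ρ ⬝ᵥ ρ)) ≤ (1 + s⁻¹) * (β * (K₅ * η ^ 3 / γ ^ 3)) := mul_le_mul_of_nonneg_left h1 h2
      _ = (1 + s⁻¹) * (β * K₅ / γ ^ 3) * η ^ 3 := by ring
  have hE3 : η ^ 2 * (lam * p₁) * (1 - α ^ 2) ≤ K₄ / γ ^ 2 * η ^ 2 * (η ^ 2 * (lam * p₁)) := by
    have := mul_le_mul_of_nonneg_left h1α (mul_nonneg (sq_nonneg η) hlp)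
    calc η ^ 2 * (lam * p₁) * (1 - α ^ 2) ≤ η ^ 2 * (lam * p₁) * (K₄ * η ^ 2 / γ ^ 2) := this
      _ = K₄ / γ ^ 2 * η ^ 2 * (η ^ 2 * (lam * p₁)) := by ring
  calc |ψ ⬝ᵥ B ψ - η ^ 2 * (lam * p₁)|
      ≤ |ψ ⬝ᵥ B ψ - η ^ 2 * α ^ 2 * (lam * p₁)| + η ^ 2 * (lam * p₁) * (1 - α ^ 2) := htri
    _ ≤ (s * (η ^ 2 * α ^ 2 * (lam * p₁)) + (1 + s⁻¹) * (β * (ρ ⬝ᵥ ρ))) + η ^ 2 * (lam * p₁) * (1 - α ^ 2) := by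
        linarith [hdef]
    _ ≤ (s + K₄ / γ ^ 2 * η ^ 2) * (η ^ 2 * (lam * p₁)) + (1 + s⁻¹) * (β * K₅ / γ ^ 3) * η ^ 3 := by
        have e : (s + K₄ / γ ^ 2 * η ^ 2) * (η ^ 2 * (lam * p₁))
            = s * (η ^ 2 * (lam * p₁)) + K₄ / γ ^ 2 * η ^ 2 * (η ^ 2 * (lam * p₁)) := by ring
        rw [e]; linarith [hE1, hE2, hE3]

end Envelope

end Summit.HubbardSuperconductivity.HubbardSuperconductivity.Theorems.AnisotropyChord.Tower
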